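import Summits.KontsevichZagierPeriods.Zeta5Search.SymmetricPhatDenominators
import Summits.KontsevichZagierPeriods.Zeta5Search.XSaveCorners
import Summits.KontsevichZagierPeriods.Zeta5Search.SymRayExplicitPQ
import HarnessLib

/-!
# The census's W-XS1 laws hold on the whole diagonal `a = n·1⁸` (cell `pub-zeta5`, seat ct-1 g46)

HONEST FRAMING: systematic search; no irrationality claim unless certified.  `p`-adic bookkeeping of Brown–Zudilin's `P̂_n`
(the `ζ(3)`-companion of the totally symmetric cellular family); nothing here concerns the arithmetic nature of `ζ(5)`/`ζ(3)`;
no `γ` / record statement; records in print UNMOVED; net named-fact debt 0.  Theorems only (0 `def`).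

OUR work (Summit side).  `XSaveConjectures.lean` (census g7, typed conjectures with exact finite evidence) states two `P̂`-side laws
about the dictionary numerator `P̂(na) = ρ(UV′ − U′V)` (`XSave.PhatOf`): W-XS1 upper half `XS1_noPrimeBeyondD` (no prime beyond
`max(m₁(na), d(b(na)))` divides den `P̂(na)`) and W-XS1 window half `XS1_windowExponentLeOne` (an odd prime beyond `m₁(na)` divides
den `P̂(na)` at most once).  On the diagonal `a = 1⁸` (`m₁(n·1⁸) = n`, `d(b(n·1⁸)) = 2n`, `P̂(n·1⁸) = P̂_n` for EVERY partner
`j ∈ [1,7]`) both are consequences of this seat's `SymmetricPhatDenominators.two_mul_lcm_sq_lcm_two_mul_Phat_isInt`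
(`2·d_n²·d_{2n}·P̂_n ∈ ℤ`): a prime `p > 2n` does not divide `2d_n²d_{2n}`, and an odd prime `p > n` divides it at most once.

* `PhatOf_aDiag` — `P̂(n·1⁸) = P̂_n` for every partner `j ∈ [1,7]` (`XSaveCorners.PhatOf_diag` is `j = 1`; the other partners by
  the relabelling invariance `SymRay.coeffU/V_update_bRay`);
* `nsmul_ones_eq_aDiag`, `m1Of_aDiag`, `dOf_aDiag` — `n • 1⁸ = n·1⁸`, `m₁ = n`, `d = 2n`;
* `padicValNat_lcmUpto` — `v_p(d_m) = ⌊log_p m⌋`; `neg_padicValNat_le_padicValRat_Phat` — `v_p(P̂_n) ≥ −v_p(2d_n²d_{2n})`;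
* **`XS1_noPrimeBeyondD_diag`**, **`XS1_windowExponentLeOne_diag`** — the two conjectured laws at `a = 1⁸`, every `n ≥ 1`, every
  partner, literally in the binder shape of `XSave.XS1_noPrimeBeyondD` / `XSave.XS1_windowExponentLeOne` specialised to `a = 1⁸`.
Nothing is claimed off the diagonal; the `P`-side laws (W-XS2) are NOT touched.
-/

noncomputable section

open Finset

namespace Summit.KontsevichZagierPeriods.Zeta5Search.SymmetricPhatXSave

open Literature.NumberTheory.Irrationality.BrownZudilin2022 (bOfA Phat Converges)
open Summit.KontsevichZagierPeriods.Zeta5Search.WedgeDictionary (rhoOf coeffU coeffV dOf)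
open Summit.KontsevichZagierPeriods.Zeta5Search.XSave (PhatOf InRegion m1Of PhatOf_diag)
open Summit.KontsevichZagierPeriods.Zeta5Search.SymRay (aDiag bRay bRay' bOfA_diag rhoOf_diag bz_Phat_ray dOf_bRay
  coeffU_update_bRay coeffV_update_bRay)
open Summit.KontsevichZagierPeriods.Zeta5Search.SymmetricPhatDenominators (two_mul_lcm_sq_lcm_two_mul_Phat_isInt)

/-! ### The diagonal in the census's coordinates -/

/-- `P̂(n·1⁸) = P̂_n` for EVERY partner `j ∈ [1,7]`. -/
theorem PhatOf_aDiag (n : ℕ) {j : ℕ} (hj1 : 1 ≤ j) (hj7 : j ≤ 7) : PhatOf (aDiag n) j = Phat n := by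
  unfold PhatOf
  simp only [bOfA_diag]
  rw [coeffU_update_bRay n hj1 hj7, coeffV_update_bRay n hj1 hj7, bz_Phat_ray n, rhoOf_diag n]

/-- `n • 1⁸ = n·1⁸` (`aDiag n`). -/
theorem nsmul_ones_eq_aDiag (n : ℕ) : n • (fun _ : Fin 8 => (1 : ℤ)) = aDiag n := by
  funext i; simp [aDiag]

/-- `m₁(n·1⁸) = n`: all twenty-eight forms `h_i` equal `n` on the diagonal. -/
theorem m1Of_aDiag (n : ℕ) : m1Of (aDiag n) = n := by
  simp only [m1Of, Literature.NumberTheory.Irrationality.BrownZudilin2022.hList, aDiag, List.foldr]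
  omega

/-- `d(b(n·1⁸)) = 2n`. -/
theorem dOf_aDiag (n : ℕ) : dOf (bOfA (aDiag n)) = 2 * n := by
  rw [bOfA_diag, dOf_bRay]

/-! ### Valuations -/

/-- `v_p(d_m) = ⌊log_p m⌋` (`d_m = lcm(1,…,m)`). -/
theorem padicValNat_lcmUpto {p : ℕ} (hp : p.Prime) (m : ℕ) : padicValNat p (Nat.lcmUpto m) = Nat.log p m := by
  rw [← Nat.factorization_def _ hp, Nat.factorization_lcmUpto m hp]

/-- `v_p(2·d_n²·d_{2n}) = v_p(2) + 2⌊log_p n⌋ + ⌊log_p 2n⌋`. -/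
theorem padicValNat_two_mul_lcm_sq_lcm {p : ℕ} [hp : Fact p.Prime] (n : ℕ) :
    padicValNat p (2 * Nat.lcmUpto n ^ 2 * Nat.lcmUpto (2 * n)) = padicValNat p 2 + 2 * Nat.log p n + Nat.log p (2 * n) := by
  rw [padicValNat.mul (mul_ne_zero two_ne_zero (pow_ne_zero _ (Nat.lcmUpto_ne_zero _))) (Nat.lcmUpto_ne_zero _),
    padicValNat.mul two_ne_zero (pow_ne_zero _ (Nat.lcmUpto_ne_zero _)), padicValNat.pow, padicValNat_lcmUpto hp.out,
    padicValNat_lcmUpto hp.out]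

/-- **`v_p(P̂_n) ≥ −v_p(2·d_n²·d_{2n})`** for every prime `p` and `n ≥ 1` (from `2d_n²d_{2n}P̂_n ∈ ℤ`). -/
theorem neg_padicValNat_le_padicValRat_Phat {p : ℕ} [hp : Fact p.Prime] (n : ℕ) (hn : 1 ≤ n) :
    -((padicValNat p 2 + 2 * Nat.log p n + Nat.log p (2 * n) : ℕ) : ℤ) ≤ padicValRat p (Phat n) := by
  obtain ⟨z, hz⟩ := two_mul_lcm_sq_lcm_two_mul_Phat_isInt n hn
  have hN : ((2 * Nat.lcmUpto n ^ 2 * Nat.lcmUpto (2 * n) : ℕ) : ℚ) ≠ 0 :=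
    Nat.cast_ne_zero.2 (mul_ne_zero (mul_ne_zero two_ne_zero (pow_ne_zero _ (Nat.lcmUpto_ne_zero _))) (Nat.lcmUpto_ne_zero _))
  have hP : Phat n = (z : ℚ) / ((2 * Nat.lcmUpto n ^ 2 * Nat.lcmUpto (2 * n) : ℕ) : ℚ) := by
    rw [eq_div_iff hN, hz]; push_cast; ring
  by_cases hz0 : z = 0
  · rw [hP, hz0]; simp; omega
  rw [hP, padicValRat.div (by exact_mod_cast hz0) hN, padicValRat.of_int, padicValRat.of_nat,
    padicValNat_two_mul_lcm_sq_lcm]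
  have : (0 : ℤ) ≤ padicValInt p z := by positivity
  linarith

/-- For a prime `p > m`: `⌊log_p m⌋ = 0`. -/
theorem log_eq_zero_of_lt {p m : ℕ} (h : m < p) : Nat.log p m = 0 := Nat.log_of_lt h

/-- For a prime `p > n ≥ 1`: `⌊log_p 2n⌋ ≤ 1` (`2n < p²`). -/
theorem log_two_mul_le_one {p n : ℕ} (hp : p.Prime) (h : n < p) : Nat.log p (2 * n) ≤ 1 := by
  rcases Nat.eq_zero_or_pos n with rfl | hn
  · simp
  have hlt : 2 * n < p ^ 2 := by nlinarith [hp.two_le]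
  have := (Nat.log_lt_iff_lt_pow hp.one_lt (by omega : 2 * n ≠ 0)).2 hlt
  omega

/-! ### W-XS1 on the diagonal -/

/-- **W-XS1, upper half, on the diagonal**: for `n ≥ 1`, every partner `j ∈ [1,7]` and every prime `p > d(b(n·1⁸)) = 2n`,
`v_p(P̂(n·1⁸)) ≥ 0` — the conclusion of `XSave.XS1_noPrimeBeyondD` at `a = 1⁸` (its hypothesis `m₁(na) < p` is implied and not needed). -/
theorem XS1_noPrimeBeyondD_diag (j n p : ℕ) (hn : 1 ≤ n) (hj : j ∈ Icc 1 7) (hp : p.Prime)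
    (hd : dOf (bOfA (aDiag n)) < p) : 0 ≤ padicValRat p (PhatOf (aDiag n) j) := by
  haveI : Fact p.Prime := ⟨hp⟩
  rw [mem_Icc] at hj
  rw [dOf_aDiag] at hd
  have hd' : 2 * n < p := by exact_mod_cast hd
  rw [PhatOf_aDiag n hj.1 hj.2]
  have h := neg_padicValNat_le_padicValRat_Phat (p := p) n hn
  rw [log_eq_zero_of_lt (by omega : n < p), log_eq_zero_of_lt hd',
    padicValNat.eq_zero_of_not_dvd (show ¬ p ∣ 2 from fun h2 => by
      have := Nat.le_of_dvd (by norm_num) h2; omega)] at h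
  simpa using h

/-- **W-XS1, window half, on the diagonal**: for `n ≥ 1`, every partner `j ∈ [1,7]` and every ODD prime `p > m₁(n·1⁸) = n`,
`v_p(P̂(n·1⁸)) ≥ −1` — the conclusion of `XSave.XS1_windowExponentLeOne` at `a = 1⁸`. -/
theorem XS1_windowExponentLeOne_diag (j n p : ℕ) (hn : 1 ≤ n) (hj : j ∈ Icc 1 7) (hp : p.Prime) (hp2 : p ≠ 2)
    (hm : m1Of (aDiag n) < p) : -1 ≤ padicValRat p (PhatOf (aDiag n) j) := by
  haveI : Fact p.Prime := ⟨hp⟩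
  rw [mem_Icc] at hj
  rw [m1Of_aDiag] at hm
  have hm' : n < p := by exact_mod_cast hm
  rw [PhatOf_aDiag n hj.1 hj.2]
  have h := neg_padicValNat_le_padicValRat_Phat (p := p) n hn
  have hlog := log_two_mul_le_one hp hm'
  rw [log_eq_zero_of_lt hm',
    padicValNat.eq_zero_of_not_dvd (show ¬ p ∣ 2 from fun h2 => hp2 ((Nat.prime_dvd_prime_iff_eq hp Nat.prime_two).1 h2))]
    at h
  push_cast at h
  omega

/-- `XSave.XS1_noPrimeBeyondD` SPECIALISED TO `a = 1⁸`, literally (all `n ≥ 1`, all partners, all primes). -/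
theorem XS1_noPrimeBeyondD_ones :
    ∀ (j n p : ℕ), 1 ≤ n → InRegion (n • (fun _ : Fin 8 => (1 : ℤ))) j → p.Prime →
      m1Of (n • (fun _ : Fin 8 => (1 : ℤ))) < p → dOf (bOfA (n • (fun _ : Fin 8 => (1 : ℤ)))) < p →
      0 ≤ padicValRat p (PhatOf (n • (fun _ : Fin 8 => (1 : ℤ))) j) := by
  intro j n p hn hR hp _ hd
  rw [nsmul_ones_eq_aDiag] at hR hd ⊢
  exact XS1_noPrimeBeyondD_diag j n p hn hR.1 hp hd

/-- `XSave.XS1_windowExponentLeOne` SPECIALISED TO `a = 1⁸`, literally (all `n ≥ 1`, all partners, all odd primes). -/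
theorem XS1_windowExponentLeOne_ones :
    ∀ (j n p : ℕ), 1 ≤ n → InRegion (n • (fun _ : Fin 8 => (1 : ℤ))) j → p.Prime → p ≠ 2 →
      m1Of (n • (fun _ : Fin 8 => (1 : ℤ))) < p → -1 ≤ padicValRat p (PhatOf (n • (fun _ : Fin 8 => (1 : ℤ))) j) := by
  intro j n p hn hR hp hp2 hm
  rw [nsmul_ones_eq_aDiag] at hR hm ⊢
  exact XS1_windowExponentLeOne_diag j n p hn hR.1 hp hp2 hm

end Summit.KontsevichZagierPeriods.Zeta5Search.SymmetricPhatXSave
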